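import Summits.NavierStokesRegularity.NavierStokesRegularity.Theorems.SqueezeCycleRecurrentLiouvilleRotationalAbsorptionFast
import HarnessLib

/-!
# Crux `RecurrentLiouville` (stmt-NavierStokesRegularity-1589), line `Sketch` — tools:
  the rotation orbit of an `L³_loc` field is continuous in `L³(Q(0,R))`

`stub_rlRotationOrbitContinuousTools`: if `u ∈ L³(Q(0, R))` for every `R > 0`, then
`θ ↦ R_θ (u ∘ T_{−θ})`, `(R_θ (u ∘ T_{−θ}))(t, x) = R_θ u(t, R_{−θ} x)`, is continuous at `θ = 0` in
`L³(Q(0, R))` for every `R > 0`.  Pure analysis (the classical `3ε` argument for the strong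
continuity of a group of measure preserving isometries on `L^p`): truncate `u` to `Q(0, R)` and
approximate the truncation `f` in `L³(ℝ × ℝ³)` by a continuous compactly supported `g`
(`MeasureTheory.MemLp.exists_hasCompactSupport_eLpNorm_sub_le`); split
`R_θ(u∘T_{−θ}) − u = (R_θ(u∘T_{−θ}) − R_θ(g∘T_{−θ})) + (R_θ(g∘T_{−θ}) − g) + (g − u)` on `Q(0, R)`.
The rotated conjugation `v ↦ R_θ ∘ v ∘ T_{−θ}` is an isometry of `L³(Q(0,R))` (the space–time
rotation preserves the cylinder and the measure, `rlRotAbs_eLpNorm_conj`), so the first and the last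
term are `≤ ‖f − g‖_{L³}`, while the middle one is uniformly small on `Q(0, R)` for `θ` near `0`
(`rlRotCont_uniform`: joint continuity of `(θ, z) ↦ R_θ g(t, R_{−θ} x) − g(t, x)` and compactness of
the closed cylinder, Mathlib's `IsCompact.eventually_forall_of_forall_eventually`), whence small in
`L³(Q(0, R))` by `eLpNorm_le_of_ae_bound` on the finite-measure cylinder.  Used by
`rotationalAbsorptionSlow`.

## References

* W. Rudin, *Real and Complex Analysis*, 3rd ed., Thm. 9.5 (continuity of translation in `L^p`).
  [folklore]
-/

noncomputable section

-- the sub-problem namespace repeats the summit name (D-0017 layout `Summit.<S>.<P>.Theorems`)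
set_option linter.dupNamespace false

namespace Summit.NavierStokesRegularity.NavierStokesRegularity.Theorems

open MeasureTheory Set Function Filter Topology TopologicalSpace Metric Literature.Analysis.FluidPDE
open scoped NNReal ENNReal

/-- The rotated conjugation defect `(θ, (t, x)) ↦ R_θ g(t, R_{−θ} x) − g(t, x)` of a continuous field
`g` on `ℝ × ℝ³` is jointly continuous in the angle and the point. [folklore] -/
theorem rlRotCont_continuous_conj
    {g : ℝ × EuclideanSpace ℝ (Fin 3) → EuclideanSpace ℝ (Fin 3)} (hg : Continuous g) :
    Continuous fun p : ℝ × (ℝ × EuclideanSpace ℝ (Fin 3)) =>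
      rotZ p.1 (g (p.2.1, rotZ (-p.1) p.2.2)) - g p.2 := by
  have h1 : Continuous fun p : ℝ × (ℝ × EuclideanSpace ℝ (Fin 3)) => rotZ (-p.1) p.2.2 :=
    continuous_rotZ_uncurry.comp₂ continuous_fst.neg continuous_snd.snd
  have h2 : Continuous fun p : ℝ × (ℝ × EuclideanSpace ℝ (Fin 3)) =>
      g (p.2.1, rotZ (-p.1) p.2.2) :=
    hg.comp₂ continuous_snd.fst h1
  have h3 : Continuous fun p : ℝ × (ℝ × EuclideanSpace ℝ (Fin 3)) =>
      rotZ p.1 (g (p.2.1, rotZ (-p.1) p.2.2)) :=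
    continuous_rotZ_uncurry.comp₂ continuous_fst h2
  exact h3.sub (hg.comp continuous_snd)

/-- The closed backward cylinders `closure Q(0, R)` are compact (bounded subsets of the proper space
`ℝ × ℝ³`). [folklore] -/
theorem rlRotCont_isCompact_closure (R : ℝ) :
    IsCompact (closure (parabolicCylinder R (0 : ℝ × EuclideanSpace ℝ (Fin 3)))) := by
  rw [SuitableCompactness.parabolicCylinder_zero]
  exact ((Metric.isBounded_Ioo _ _).prod Metric.isBounded_ball).isCompact_closure

/-- **Uniform smallness of `R_θ g(t, R_{−θ} x) − g(t, x)` on a backward cylinder.**  For a continuous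
`g` on `ℝ × ℝ³`, `R` and `η > 0`, every `θ` close enough to `0` satisfies
`‖R_θ g(t, R_{−θ} x) − g(t, x)‖ ≤ η` for all `(t, x) ∈ Q(0, R)`: the defect is jointly continuous
(`rlRotCont_continuous_conj`), vanishes at `θ = 0` (`rotZ_zero`), and the closed cylinder is compact
(`rlRotCont_isCompact_closure`), so the tube lemma
(`IsCompact.eventually_forall_of_forall_eventually`) applies. [folklore] -/
theorem rlRotCont_uniform
    {g : ℝ × EuclideanSpace ℝ (Fin 3) → EuclideanSpace ℝ (Fin 3)} (hg : Continuous g)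
    (R : ℝ) {η : ℝ} (hη : 0 < η) :
    ∀ᶠ θ : ℝ in 𝓝 0, ∀ z ∈ parabolicCylinder R (0 : ℝ × EuclideanSpace ℝ (Fin 3)),
      ‖rotZ θ (g (z.1, rotZ (-θ) z.2)) - g z‖ ≤ η := by
  have hP : ∀ y ∈ closure (parabolicCylinder R (0 : ℝ × EuclideanSpace ℝ (Fin 3))),
      ∀ᶠ p : ℝ × (ℝ × EuclideanSpace ℝ (Fin 3)) in 𝓝 ((0 : ℝ), y),
        ‖rotZ p.1 (g (p.2.1, rotZ (-p.1) p.2.2)) - g p.2‖ ≤ η := by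
    intro y _
    have ht : Tendsto (fun p : ℝ × (ℝ × EuclideanSpace ℝ (Fin 3)) =>
        ‖rotZ p.1 (g (p.2.1, rotZ (-p.1) p.2.2)) - g p.2‖) (𝓝 ((0 : ℝ), y)) (𝓝 0) := by
      have h := ((rlRotCont_continuous_conj hg).tendsto ((0 : ℝ), y)).norm
      simp only [neg_zero, rotZ_zero, Prod.mk.eta, sub_self, norm_zero] at h
      exact h
    filter_upwards [ht.eventually_lt_const hη] with p hp
    exact hp.le
  have h := (rlRotCont_isCompact_closure R).eventually_forall_of_forall_eventually
    (x₀ := (0 : ℝ)) (P := fun (θ : ℝ) (z : ℝ × EuclideanSpace ℝ (Fin 3)) =>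
      ‖rotZ θ (g (z.1, rotZ (-θ) z.2)) - g z‖ ≤ η) hP
  filter_upwards [h] with θ hθ z hz
  exact hθ z (subset_closure hz)

/-- **Registered tools stub `stub_rlRotationOrbitContinuousTools`** (crux stmt-NavierStokesRegularity-1589,
line Sketch): the rotation orbit `θ ↦ R_θ (u ∘ T_{−θ})` of a field `u ∈ L³(Q(0,R))` (all `R > 0`) is
continuous at `θ = 0` in `L³(Q(0, R))` for every `R > 0`:
`‖R_θ u(t, R_{−θ} x) − u(t, x)‖_{L³(Q(0,R))} → 0` as `θ → 0`.  Truncate `u` to `Q(0, R)` and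
approximate in `L³(volume)` by a continuous compactly supported `g`
(`MeasureTheory.MemLp.exists_hasCompactSupport_eLpNorm_sub_le`);
`‖R_θ(u∘T_{−θ}) − u‖ ≤ ‖R_θ(u∘T_{−θ}) − R_θ(g∘T_{−θ})‖ + ‖R_θ(g∘T_{−θ}) − g‖ + ‖g − u‖` on `Q(0,R)`,
the first term equals `‖u − g‖_{L³(Q(0,R))}` (`rlRotAbs_eLpNorm_conj`, the rotated conjugation is a
measure preserving isometry of the cylinder), the last is `≤ ‖f − g‖_{L³}`, and the middle one is
uniformly small on `Q(0, R)` (`rlRotCont_uniform`), then `eLpNorm_le_of_ae_bound` on the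
finite-measure cylinder. [folklore] -/
theorem stub_rlRotationOrbitContinuousTools :
    ∀ (u : ℝ → EuclideanSpace ℝ (Fin 3) → EuclideanSpace ℝ (Fin 3)),
      (∀ R : ℝ, 0 < R → MemLp (uncurry u) 3
        (volume.restrict (parabolicCylinder R (0 : ℝ × EuclideanSpace ℝ (Fin 3))))) →
      ∀ R : ℝ, 0 < R → Tendsto (fun θ : ℝ => eLpNorm (fun z : ℝ × EuclideanSpace ℝ (Fin 3) =>
          rotZ θ (u z.1 (rotZ (-θ) z.2)) - u z.1 z.2) 3
        (volume.restrict (parabolicCylinder R (0 : ℝ × EuclideanSpace ℝ (Fin 3))))) (𝓝 0) (𝓝 0) := by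
  intro u hu R hR
  rw [ENNReal.tendsto_nhds_zero]
  intro ε hε
  -- the constants: `V = |Q(0,R)|^{1/3}`, `A = V + 1`
  set V : ℝ≥0∞ := volume (parabolicCylinder R (0 : ℝ × EuclideanSpace ℝ (Fin 3))) ^
    (3 : ℝ≥0∞).toReal⁻¹ with hV
  have hVtop : V ≠ ⊤ := ENNReal.rpow_ne_top_of_nonneg (by norm_num)
    (SuitableCompactness.volume_parabolicCylinder_zero_ne_top R)
  set A : ℝ≥0∞ := V + 1 with hA
  have hAtop : A ≠ ⊤ := ENNReal.add_ne_top.2 ⟨hVtop, ENNReal.one_ne_top⟩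
  have h1A : 1 ≤ A := le_add_self
  have hA0 : A ≠ 0 := (lt_of_lt_of_le one_pos h1A).ne'
  set δ : ℝ≥0∞ := ε / 3 with hδ
  have hδ0 : δ ≠ 0 := (ENNReal.div_pos hε.ne' (by norm_num)).ne'
  set η : ℝ≥0∞ := min (δ / A) 1 with hη
  have hη0 : η ≠ 0 := (lt_min (ENNReal.div_pos hδ0 hAtop) one_pos).ne'
  have hηtop : η ≠ ⊤ := ne_top_of_le_ne_top ENNReal.one_ne_top (min_le_right _ _)
  have hAη : A * η ≤ δ :=
    (mul_le_mul' le_rfl (min_le_left _ _)).trans_eq (ENNReal.mul_div_cancel hA0 hAtop)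
  have hVη : V * η ≤ δ := (mul_le_mul' (le_self_add : V ≤ V + 1) le_rfl).trans hAη
  have hηδ : η ≤ δ := (le_mul_of_one_le_left bot_le h1A).trans hAη
  have hη'0 : 0 < η.toReal := ENNReal.toReal_pos hη0 hηtop
  have hofReal : ENNReal.ofReal η.toReal = η := ENNReal.ofReal_toReal hηtop
  -- truncation to `Q(0, R)` and `C_c` approximation
  have hmeas : MeasurableSet (parabolicCylinder R (0 : ℝ × EuclideanSpace ℝ (Fin 3))) :=
    (isOpen_parabolicCylinder _ _).measurableSet
  set f : ℝ × EuclideanSpace ℝ (Fin 3) → EuclideanSpace ℝ (Fin 3) :=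
    (parabolicCylinder R (0 : ℝ × EuclideanSpace ℝ (Fin 3))).indicator (uncurry u) with hf
  have hfL : MemLp f 3 volume := by
    rw [hf, memLp_indicator_iff_restrict hmeas]
    exact hu R hR
  obtain ⟨g, -, hfg, hgc, -⟩ :=
    hfL.exists_hasCompactSupport_eLpNorm_sub_le (by norm_num : (3 : ℝ≥0∞) ≠ ⊤) hη0
  have hgm : AEStronglyMeasurable g
      (volume.restrict (parabolicCylinder R (0 : ℝ × EuclideanSpace ℝ (Fin 3)))) :=
    hgc.aestronglyMeasurable
  -- on `Q(0, R)` the field `u` is its truncation `f`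
  have huf : (uncurry u : ℝ × EuclideanSpace ℝ (Fin 3) → EuclideanSpace ℝ (Fin 3)) =ᵐ[volume.restrict
      (parabolicCylinder R (0 : ℝ × EuclideanSpace ℝ (Fin 3)))] f := by
    filter_upwards [ae_restrict_mem hmeas] with z hz
    rw [hf, indicator_of_mem hz]
  filter_upwards [rlRotCont_uniform hgc R hη'0] with θ hθu
  -- measurability of the four fields on `Q(0, R)`
  have hum : AEStronglyMeasurable (uncurry u)
      (volume.restrict (parabolicCylinder R (0 : ℝ × EuclideanSpace ℝ (Fin 3)))) := (hu R hR).1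
  have hFm : AEStronglyMeasurable
      (fun z : ℝ × EuclideanSpace ℝ (Fin 3) => rotZ θ (u z.1 (rotZ (-θ) z.2)))
      (volume.restrict (parabolicCylinder R (0 : ℝ × EuclideanSpace ℝ (Fin 3)))) :=
    rlRotAbs_aesm_conj θ R (g := uncurry u) hum
  have hGm : AEStronglyMeasurable
      (fun z : ℝ × EuclideanSpace ℝ (Fin 3) => rotZ θ (g (z.1, rotZ (-θ) z.2)))
      (volume.restrict (parabolicCylinder R (0 : ℝ × EuclideanSpace ℝ (Fin 3)))) :=
    rlRotAbs_aesm_conj θ R hgm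
  -- Term 1: `‖R_θ(u∘T_{−θ}) − R_θ(g∘T_{−θ})‖ = ‖u − g‖ = ‖f − g‖ ≤ η` on `Q(0, R)`
  have hT1 : eLpNorm ((fun z : ℝ × EuclideanSpace ℝ (Fin 3) => rotZ θ (u z.1 (rotZ (-θ) z.2))) -
        (fun z : ℝ × EuclideanSpace ℝ (Fin 3) => rotZ θ (g (z.1, rotZ (-θ) z.2)))) 3
      (volume.restrict (parabolicCylinder R (0 : ℝ × EuclideanSpace ℝ (Fin 3)))) ≤ η := by
    have h1 := rlRotAbs_eLpNorm_conj θ R hum hgm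
    have e : (fun z : ℝ × EuclideanSpace ℝ (Fin 3) => rotZ θ (u z.1 (rotZ (-θ) z.2))) -
        (fun z : ℝ × EuclideanSpace ℝ (Fin 3) => rotZ θ (g (z.1, rotZ (-θ) z.2))) =
        fun z : ℝ × EuclideanSpace ℝ (Fin 3) =>
          rotZ θ (uncurry u (z.1, rotZ (-θ) z.2)) - rotZ θ (g (z.1, rotZ (-θ) z.2)) := rfl
    rw [e, h1]
    calc eLpNorm (uncurry u - g) 3
          (volume.restrict (parabolicCylinder R (0 : ℝ × EuclideanSpace ℝ (Fin 3))))
        = eLpNorm (f - g) 3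
          (volume.restrict (parabolicCylinder R (0 : ℝ × EuclideanSpace ℝ (Fin 3)))) :=
          eLpNorm_congr_ae (huf.sub (ae_eq_refl g))
      _ ≤ eLpNorm (f - g) 3 volume := eLpNorm_mono_measure _ Measure.restrict_le_self
      _ ≤ η := hfg
  -- Term 2: `‖R_θ(g∘T_{−θ}) − g‖ ≤ |Q(0,R)|^{1/3} η`
  have hT2 : eLpNorm ((fun z : ℝ × EuclideanSpace ℝ (Fin 3) => rotZ θ (g (z.1, rotZ (-θ) z.2))) - g) 3
      (volume.restrict (parabolicCylinder R (0 : ℝ × EuclideanSpace ℝ (Fin 3)))) ≤ V * η := by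
    have hbound : ∀ᵐ z ∂(volume.restrict (parabolicCylinder R (0 : ℝ × EuclideanSpace ℝ (Fin 3)))),
        ‖((fun z : ℝ × EuclideanSpace ℝ (Fin 3) => rotZ θ (g (z.1, rotZ (-θ) z.2))) - g) z‖ ≤
          η.toReal := by
      filter_upwards [ae_restrict_mem hmeas] with z hz
      exact hθu z hz
    calc eLpNorm ((fun z : ℝ × EuclideanSpace ℝ (Fin 3) => rotZ θ (g (z.1, rotZ (-θ) z.2))) - g) 3
          (volume.restrict (parabolicCylinder R (0 : ℝ × EuclideanSpace ℝ (Fin 3))))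
        ≤ (volume.restrict (parabolicCylinder R (0 : ℝ × EuclideanSpace ℝ (Fin 3)))) univ ^
            (3 : ℝ≥0∞).toReal⁻¹ * ENNReal.ofReal η.toReal := eLpNorm_le_of_ae_bound hbound
      _ = V * η := by rw [Measure.restrict_apply_univ, hofReal]
  -- Term 3: `‖g − u‖ ≤ ‖f − g‖ ≤ η`
  have hT3 : eLpNorm (g - uncurry u) 3
      (volume.restrict (parabolicCylinder R (0 : ℝ × EuclideanSpace ℝ (Fin 3)))) ≤ η := by
    calc eLpNorm (g - uncurry u) 3
          (volume.restrict (parabolicCylinder R (0 : ℝ × EuclideanSpace ℝ (Fin 3))))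
        = eLpNorm (g - f) 3
          (volume.restrict (parabolicCylinder R (0 : ℝ × EuclideanSpace ℝ (Fin 3)))) :=
          eLpNorm_congr_ae ((ae_eq_refl g).sub huf)
      _ ≤ eLpNorm (g - f) 3 volume := eLpNorm_mono_measure _ Measure.restrict_le_self
      _ = eLpNorm (f - g) 3 volume := eLpNorm_sub_comm _ _ _ _
      _ ≤ η := hfg
  -- the `3ε` split
  have e : (fun z : ℝ × EuclideanSpace ℝ (Fin 3) => rotZ θ (u z.1 (rotZ (-θ) z.2)) - u z.1 z.2) =
      ((fun z : ℝ × EuclideanSpace ℝ (Fin 3) => rotZ θ (u z.1 (rotZ (-θ) z.2))) -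
        (fun z : ℝ × EuclideanSpace ℝ (Fin 3) => rotZ θ (g (z.1, rotZ (-θ) z.2)))) +
      (((fun z : ℝ × EuclideanSpace ℝ (Fin 3) => rotZ θ (g (z.1, rotZ (-θ) z.2))) - g) +
        (g - uncurry u)) := by
    rw [sub_add_sub_cancel, sub_add_sub_cancel]
    rfl
  rw [e]
  calc eLpNorm (((fun z : ℝ × EuclideanSpace ℝ (Fin 3) => rotZ θ (u z.1 (rotZ (-θ) z.2))) -
        (fun z : ℝ × EuclideanSpace ℝ (Fin 3) => rotZ θ (g (z.1, rotZ (-θ) z.2)))) +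
      (((fun z : ℝ × EuclideanSpace ℝ (Fin 3) => rotZ θ (g (z.1, rotZ (-θ) z.2))) - g) +
        (g - uncurry u))) 3
        (volume.restrict (parabolicCylinder R (0 : ℝ × EuclideanSpace ℝ (Fin 3))))
      ≤ eLpNorm ((fun z : ℝ × EuclideanSpace ℝ (Fin 3) => rotZ θ (u z.1 (rotZ (-θ) z.2))) -
          (fun z : ℝ × EuclideanSpace ℝ (Fin 3) => rotZ θ (g (z.1, rotZ (-θ) z.2)))) 3
          (volume.restrict (parabolicCylinder R (0 : ℝ × EuclideanSpace ℝ (Fin 3)))) +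
        eLpNorm ((((fun z : ℝ × EuclideanSpace ℝ (Fin 3) => rotZ θ (g (z.1, rotZ (-θ) z.2))) - g) +
          (g - uncurry u))) 3
          (volume.restrict (parabolicCylinder R (0 : ℝ × EuclideanSpace ℝ (Fin 3)))) :=
        eLpNorm_add_le (hFm.sub hGm) ((hGm.sub hgm).add (hgm.sub hum)) (by norm_num)
    _ ≤ η + (V * η + η) :=
        add_le_add hT1 ((eLpNorm_add_le (hGm.sub hgm) (hgm.sub hum) (by norm_num)).trans
          (add_le_add hT2 hT3))
    _ ≤ δ + (δ + δ) := add_le_add hηδ (add_le_add hVη hηδ)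
    _ = ε := by rw [← add_assoc, hδ, ENNReal.add_thirds]

end Summit.NavierStokesRegularity.NavierStokesRegularity.Theorems

end
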